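import Mathlib
import Summits.BirchSwinnertonDyer.BirchSwinnertonDyer.Theorems.ResidualThetaTransportAtTwoSignedMuSeedAtTwoPlusNonsquareDescentEngine
import HarnessLib

/-!
# Non-square descent — THE STRUCTURE «`V_∞ ≅ 𝔽₄⟦T⟧ ⊕ finite`» FROM RANK ONE (stub S3 (c) of the line card `nonsquare-descent`, DERIVED)
# for the seed crux `SignedMuSeedAtTwoPlus` stmt-BirchSwinnertonDyer-21438 (parent Kμ⁺ `SignedMuVanishingAtTwoPlus`
# stmt-BirchSwinnertonDyer-20689, route ResidualThetaTransportAtTwo)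

Cell `bsd-wall`, width seat `bsd-wall-rtt-p4-w2` g18 (`--supports`, closes nothing).  THEOREMS ONLY; BSD is not proved by this and
nothing arithmetic is asserted: module algebra over a principal ideal domain / over `k⟦X⟧` with `k` finite.

Stub S3 (c) of `Cruxes/SignedMuSeedAtTwoPlus/Lines/nonsquare-descent.md` asserts «`V_∞ = Ē^χ/2 ≅ 𝔽₄⟦T⟧ ⊕ finite`», which seat g17 took
as the INPUT `e : V ≃ₗ[S] (S × F)`, `hF` of `rank_le_one_of_linearEquiv_prod` / `exists_nonTorsion_of_linearEquiv_prod`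
(`Theorems/…NonsquareDescentMuCriterion.lean` §4).  With `hrank` and `hw` now DERIVED from «`Ē^χ` a rank-one lattice»
(`Theorems/…NonsquareDescentRankOneModP.lean`, `…RankOneNonTorsion.lean`), this file closes the circle: over a PID, **finitely
generated + rank `≤ 1` + one non-torsion element ⟺ `V ≃ S × F` with `F` finitely generated torsion**, and over `S = k⟦X⟧` with `k`
finite the torsion part `F` is FINITE.  Dictionary: `S = 𝔽₄⟦T⟧`, `V = V_∞`, `F` = the finite part.

* §1 `prod_pow_smul_directSum_eq_zero`, **`exists_linearEquiv_prod_of_rank_le_one`** — Mathlib's structure theorem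
  (`Module.equiv_free_prod_directSum`) with the free rank pinned to `1` by `hrank` (`≤ 1`) and `hw` (`≥ 1`).
* §2 **`finite_of_fg_of_smul_eq_zero`** — a finitely generated module killed by one `c` with `S/(c)` finite is finite (any commutative
  ring; explicit surjection from `(generators → S/(c))`, no instance transport).
* §3 `finite_powerSeries_quotient_span_X_pow`, `finite_powerSeries_quotient_span` — `k⟦X⟧/(q)` is finite for `q ≠ 0`, `k` a finite
  field; `finite_of_fg_torsion_powerSeries`.
* §4 **`exists_linearEquiv_prod_finite_powerSeries`** — over `k⟦X⟧`, `k` finite: f.g. + `hrank` + `hw` ⇒ `V ≃ k⟦X⟧ × F` with `F` FINITE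
  and torsion (LITERALLY the inputs `e`, `hF` of `rank_le_one_of_linearEquiv_prod`): the card's «`V_∞ ≅ 𝔽₄⟦T⟧ ⊕ finite`».

[folklore]
-/

set_option autoImplicit false
-- the Theorems namespace of this sub repeats the summit name by design (D-0017 nested layout)
set_option linter.dupNamespace false

open scoped DirectSum

universe u v

namespace Summit.BirchSwinnertonDyer.BirchSwinnertonDyer.Theorems.SignedMuAtTwo.NonsquareDescent

/-! ## §1 Over a PID: rank one pins the free part of the structure theorem -/

section PID

variable {S : Type u} [CommRing S] {V : Type v} [AddCommGroup V] [Module S V]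

/-- The torsion part `⨁ i, S/(pᵢ^{eᵢ})` of the structure theorem is killed by `∏ i, pᵢ^{eᵢ}`. [folklore] -/
theorem prod_pow_smul_directSum_eq_zero {ι : Type*} [Fintype ι] [DecidableEq ι] (p : ι → S) (e : ι → ℕ)
    (d : ⨁ i, S ⧸ Submodule.span S {p i ^ e i}) : (∏ i, p i ^ e i) • d = 0 := by
  ext i
  rw [DirectSum.smul_apply, DirectSum.zero_apply]
  obtain ⟨x, hx⟩ := Submodule.Quotient.mk_surjective _ (d i)
  rw [← hx, ← Submodule.Quotient.mk_smul, Submodule.Quotient.mk_eq_zero, smul_eq_mul,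
    ← Finset.prod_erase_mul Finset.univ (fun j => p j ^ e j) (Finset.mem_univ i)]
  exact Submodule.mem_span_singleton.mpr
    ⟨(∏ j ∈ Finset.univ.erase i, p j ^ e j) * x, by rw [smul_eq_mul]; ring⟩

variable [IsDomain S] [IsPrincipalIdealRing S]

/-- **Over a PID: f.g. + rank `≤ 1` + a non-torsion element ⇒ `V ≃ S × F` with `F` f.g. torsion.**  Mathlib's structure theorem gives
`V ≃ Sⁿ × ⨁ S/(pᵢ^{eᵢ})`; two independent free coordinates would violate `hrank`, and `n = 0` would make the non-torsion element `w`
torsion; so `n = 1`.  The output is exactly the input shape of `rank_le_one_of_linearEquiv_prod` /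
`exists_nonTorsion_of_linearEquiv_prod` (with `hF` in the uniform form `∃ c ≠ 0, ∀ f, c • f = 0`). [folklore] -/
theorem exists_linearEquiv_prod_of_rank_le_one [Module.Finite S V]
    (hrank : ∀ v w : V, ∃ a b : S, (a ≠ 0 ∨ b ≠ 0) ∧ a • v + b • w = 0)
    (hw : ∃ w : V, ∀ b : S, b ≠ 0 → b • w ≠ 0) :
    ∃ (F : Type u) (_ : AddCommGroup F) (_ : Module S F),
      Module.Finite S F ∧ (∃ c : S, c ≠ 0 ∧ ∀ f : F, c • f = 0) ∧ Nonempty (V ≃ₗ[S] (S × F)) := by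
  classical
  obtain ⟨n, ι, _, p, hp, e, ⟨f⟩⟩ := Module.equiv_free_prod_directSum S V
  have hc : (∏ i, p i ^ e i) ≠ 0 :=
    Finset.prod_ne_zero_iff.mpr fun i _ => pow_ne_zero _ (hp i).ne_zero
  have htor : ∀ d : ⨁ i, S ⧸ Submodule.span S {p i ^ e i}, (∏ i, p i ^ e i) • d = 0 :=
    prod_pow_smul_directSum_eq_zero p e
  have hfinF : Module.Finite S (⨁ i, S ⧸ Submodule.span S {p i ^ e i}) :=
    Module.Finite.of_surjective ((LinearMap.snd S _ _).comp f.toLinearMap)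
      (Prod.snd_surjective.comp f.surjective)
  have hn1 : n = 1 := by
    rcases Nat.lt_trichotomy n 1 with hlt | heq | hgt
    · exfalso
      have hn0 : n = 0 := by omega
      subst hn0
      obtain ⟨w, hw⟩ := hw
      apply hw _ hc
      apply f.injective
      rw [map_smul, map_zero, Prod.ext_iff]
      refine ⟨Finsupp.ext fun i => Fin.elim0 i, ?_⟩
      rw [Prod.smul_snd, Prod.snd_zero, htor]
    · exact heq
    · exfalso
      obtain ⟨a, b, hab, h⟩ :=
        hrank (f.symm (Finsupp.single ⟨0, by omega⟩ 1, 0)) (f.symm (Finsupp.single ⟨1, by omega⟩ 1, 0))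
      have h1 : a • Finsupp.single (⟨0, by omega⟩ : Fin n) (1 : S) + b • Finsupp.single ⟨1, by omega⟩ 1 = 0 := by
        have h2 := congrArg (fun v => (f v).1) h
        simp only [map_add, map_smul, LinearEquiv.apply_symm_apply, Prod.fst_add, Prod.smul_fst, map_zero,
          Prod.fst_zero] at h2
        exact h2
      have ha : a = 0 := by
        have h3 := Finsupp.ext_iff.mp h1 ⟨0, by omega⟩
        simpa [Finsupp.single_apply] using h3
      have hb : b = 0 := by
        have h3 := Finsupp.ext_iff.mp h1 ⟨1, by omega⟩
        simpa [Finsupp.single_apply] using h3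
      rcases hab with h' | h'
      · exact h' ha
      · exact h' hb
  subst hn1
  exact ⟨⨁ i, S ⧸ Submodule.span S {p i ^ e i}, inferInstance, inferInstance, hfinF, ⟨_, hc, htor⟩,
    ⟨f.trans ((Finsupp.uniqueLinearEquiv S S (0 : Fin 1)).prodCongr (LinearEquiv.refl S _))⟩⟩

end PID

/-! ## §2 A finitely generated module killed by `c` with `S/(c)` finite is finite -/

section FiniteTorsion

variable {S : Type*} [CommRing S] {F : Type*} [AddCommGroup F] [Module S F]

/-- **f.g. + `c • F = 0` + `S/(c)` finite ⇒ `F` finite**: `F` is the image of the finite set `(generators → S/(c))` under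
`r ↦ ∑ (lift r_g) • g`. (Any commutative ring; no module structure over `S/(c)` is transported.) [folklore] -/
theorem finite_of_fg_of_smul_eq_zero [Module.Finite S F] {c : S}
    (hfin : Finite (S ⧸ Ideal.span {c})) (hc : ∀ f : F, c • f = 0) : Finite F := by
  classical
  obtain ⟨s, hs⟩ := Module.Finite.fg_top (R := S) (M := F)
  have hsec := Ideal.Quotient.mk_surjective (I := Ideal.span {c})
  choose sec hsec using hsec
  haveI : Finite (↥s → S ⧸ Ideal.span {c}) := Pi.finite
  refine Finite.of_surjective (fun r : ↥s → S ⧸ Ideal.span {c} => ∑ g : ↥s, sec (r g) • (g : F)) fun x => ?_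
  have hx : x ∈ Submodule.span S (s : Set F) := by rw [hs]; exact Submodule.mem_top
  obtain ⟨r, hr⟩ := Submodule.mem_span_finset'.mp hx
  refine ⟨fun g => Ideal.Quotient.mk _ (r g), ?_⟩
  simp only
  rw [← hr]
  refine Finset.sum_congr rfl fun g _ => ?_
  have h1 : sec (Ideal.Quotient.mk _ (r g)) - r g ∈ Ideal.span {c} := by
    rw [← Ideal.Quotient.eq, hsec]
  obtain ⟨t, ht⟩ := Ideal.mem_span_singleton'.mp h1
  have h2 : (sec (Ideal.Quotient.mk _ (r g)) - r g) • (g : F) = 0 := by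
    rw [← ht, mul_smul, hc, smul_zero]
  rwa [sub_smul, sub_eq_zero] at h2

end FiniteTorsion

/-! ## §3 `k⟦X⟧/(q)` is finite for `q ≠ 0`, `k` finite -/

section PowerSeriesQuot

/-- `k⟦X⟧ ⧸ (Xⁿ)` is finite for `k` finite: a class is determined by its first `n` coefficients. [folklore] -/
theorem finite_powerSeries_quotient_span_X_pow {k : Type*} [CommRing k] [Finite k] (n : ℕ) :
    Finite (PowerSeries k ⧸ Ideal.span {(PowerSeries.X : PowerSeries k) ^ n}) := by
  classical
  have hsec := Ideal.Quotient.mk_surjective (I := Ideal.span {(PowerSeries.X : PowerSeries k) ^ n})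
  choose sec hsec using hsec
  refine Finite.of_injective (fun x => fun i : Fin n => PowerSeries.coeff (i : ℕ) (sec x)) fun x y hxy => ?_
  rw [← hsec x, ← hsec y, Ideal.Quotient.eq, Ideal.mem_span_singleton, PowerSeries.X_pow_dvd_iff]
  intro m hm
  have h1 := congrFun hxy ⟨m, hm⟩
  simp only at h1
  rw [map_sub, h1, sub_self]

/-- `k⟦X⟧ ⧸ (q)` is finite for `q ≠ 0`, `k` a finite field (`q = X^{ord q}·unit`). [folklore] -/
theorem finite_powerSeries_quotient_span {k : Type*} [Field k] [Finite k] {q : PowerSeries k} (hq : q ≠ 0) :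
    Finite (PowerSeries k ⧸ Ideal.span {q}) := by
  obtain ⟨a, w, hw, rfl⟩ := powerSeries_eq_X_pow_mul_unit q hq
  rw [Ideal.span_singleton_mul_right_unit hw]
  exact finite_powerSeries_quotient_span_X_pow a

/-- **A finitely generated `k⟦X⟧`-module killed by some `c ≠ 0` is finite** (`k` a finite field): the «finite» in
«`V_∞ ≅ 𝔽₄⟦T⟧ ⊕ finite`». [folklore] -/
theorem finite_of_fg_torsion_powerSeries {k : Type*} [Field k] [Finite k] {F : Type*} [AddCommGroup F]
    [Module (PowerSeries k) F] [Module.Finite (PowerSeries k) F]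
    {c : PowerSeries k} (hc : c ≠ 0) (hcF : ∀ f : F, c • f = 0) : Finite F := by
  have hfin : Finite (PowerSeries k ⧸ Ideal.span {c}) := finite_powerSeries_quotient_span hc
  exact finite_of_fg_of_smul_eq_zero (S := PowerSeries k) (F := F) (c := c) hfin hcF

end PowerSeriesQuot

/-! ## §4 `V_∞ ≅ k⟦X⟧ ⊕ finite` -/

section PowerSeriesStructure

/-- **«`V_∞ ≅ 𝔽₄⟦T⟧ ⊕ finite`» DERIVED.**  Over `k⟦X⟧` with `k` a finite field, a finitely generated module of rank `≤ 1` (any two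
elements dependent) with a non-torsion element is `≃ k⟦X⟧ × F` with `F` FINITE and torsion (`hF` in the form consumed by
`rank_le_one_of_linearEquiv_prod`).  Combined with `rank_le_one_modP_of_injective` and `exists_nonTorsion_mkQ_of_ringHom` the inputs are:
`Ē^χ ↪ Λ'` a non-zero rank-one lattice, `V_∞ = Ē^χ/2` finitely generated over `𝔽₄⟦T⟧`. [folklore] -/
theorem exists_linearEquiv_prod_finite_powerSeries {k : Type u} [Field k] [Finite k] {V : Type v} [AddCommGroup V]
    [Module (PowerSeries k) V] [Module.Finite (PowerSeries k) V]
    (hrank : ∀ v w : V, ∃ a b : PowerSeries k, (a ≠ 0 ∨ b ≠ 0) ∧ a • v + b • w = 0)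
    (hw : ∃ w : V, ∀ b : PowerSeries k, b ≠ 0 → b • w ≠ 0) :
    ∃ (F : Type u) (_ : AddCommGroup F) (_ : Module (PowerSeries k) F),
      Finite F ∧ (∀ f : F, ∃ c : PowerSeries k, c ≠ 0 ∧ c • f = 0) ∧
        Nonempty (V ≃ₗ[PowerSeries k] (PowerSeries k × F)) := by
  obtain ⟨F, _, _, hfg, ⟨c, hc, hcF⟩, he⟩ := exists_linearEquiv_prod_of_rank_le_one (S := PowerSeries k) hrank hw
  exact ⟨F, inferInstance, inferInstance, finite_of_fg_torsion_powerSeries hc hcF, fun f => ⟨c, hc, hcF f⟩, he⟩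

end PowerSeriesStructure

end Summit.BirchSwinnertonDyer.BirchSwinnertonDyer.Theorems.SignedMuAtTwo.NonsquareDescent
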